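import Mathlib
import Summits.QuantumAdvantage.QuantumAdvantage.Theorems.LinnikCubicClassGroupsPureCubicClassNumberHardHonda25Prime
import HarnessLib

/-!
# Honda 1971 for `m = pq`: the wild prime and the field set-up (conductor `3pq` / `9pq`)

Route `LinnikCubicClassGroups` (rank-0 hypothesis-type target `PureCubicClassNumberHard`,
stmt-QuantumAdvantage-11826): classical arithmetic of the pure cubic fields `ℚ(∛m)` whose class
numbers the booked theorem `pureCubicClassNumber_lowBits_mem_FBQP` computes.  This file prepares
the Hasse-free proof of **`3 ∣ h(ℚ(∛(pq)))` for distinct primes `p, q ≡ 2 (mod 3)` with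
`pq ≢ ±1 (mod 9)`** (Honda 1971, Theorem; the conductor of `ℚ(∛(pq), ζ₃)/ℚ(ζ₃)` is `3pq` or `9pq`,
not in the exceptional list of [AouissiMayerIsmailiTalbiAzizi2020, Thm. 2.3]), completed in
`…HondaTwoInertPrimes.lean`.

* `eq_pow_of_pow_three_eq` — `I³ = P^{3n}` forces `I = Pⁿ` (Dedekind domains);
* `exists_span_three_eq_cube` — for a cubic `K ∋ ∛m`, `3 ∤ m`, `m ≢ ±1 (mod 9)`: `3𝓞_K = 𝔮³`
  (Dedekind's "first species": `3` is totally ramified in `K`);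
* `exists_wild_prime_of_mod_nine` — in `L = K(ζ₃) ⊃ F = ℚ(ζ₃)` the unique prime `𝔏 ∋ 3` has
  `e(𝔏 | F) = 3`, `3𝓞_L = 𝔏⁶` and `𝔏³ = λ𝓞_L` with `λ ∈ 𝓞_F`;
* `fieldSetup_twoPrimes` — the Galois/unit/ramification data of `L/F/ℚ` for `K ∋ ∛(pq)`:
  `F = ℚ(ζ₃)` is a PID with units `±ζ₃ⁱ`, `Gal(L/F)` is cyclic of order `3`, and the primes
  `P₁ ∋ p`, `P₂ ∋ q` of `L` satisfy `p𝓞_L = P₁³`, `q𝓞_L = P₂³`, `e(Pᵢ | F) = 3`.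

HONEST FRAMING (block-2b rule): kernel-checked classical algebraic number theory (Honda 1971,
Dedekind 1900), an independent certification, NOT summit progress; the crux
`PureCubicClassNumberHard` is hypothesis-type and untouched.

## References
* T. Honda, *Pure cubic fields whose class numbers are multiples of three*, J. Number Theory 3
  (1971) 7–12, Theorem. [Honda1971]
* R. Dedekind, *Über die Anzahl der Idealklassen in reinen kubischen Zahlkörpern*, J. reine angew.
  Math. 121 (1900) 40–123 (decomposition of `3`). [folklore]
* S. Aouissi, D. C. Mayer, M. C. Ismaili, M. Talbi, A. Azizi, Period. Math. Hungar. 81 (2020),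
  Thm. 2.3. [AouissiMayerIsmailiTalbiAzizi2020]
-/

set_option linter.dupNamespace false

noncomputable section

open NumberField Polynomial

open scoped Pointwise NumberField IntermediateField

namespace Summit.QuantumAdvantage.QuantumAdvantage.Theorems.LinnikCubicClassGroups

open Literature.NumberTheory.NumberFields IsDedekindDomain

/-! ### Cube roots of ideals -/

/-- In a Dedekind domain, `I³ = P^{3n}` for a maximal `P` forces `I = P^n`. [folklore] -/
theorem eq_pow_of_pow_three_eq {R : Type*} [CommRing R] [IsDedekindDomain R] {I P : Ideal R}
    (hP : P.IsMaximal) (hP0 : P ≠ ⊥) {n : ℕ} (h : I ^ 3 = P ^ (3 * n)) : I = P ^ n := by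
  have hprime : Prime P := Ideal.prime_of_isPrime hP0 hP.isPrime
  have hdvd : I ∣ P ^ (3 * n) := ⟨I ^ 2, by rw [← h]; ring⟩
  obtain ⟨i, -, hi⟩ := (dvd_prime_pow hprime _).mp hdvd
  have hIeq : I = P ^ i := associated_iff_eq.mp hi
  rw [hIeq, ← pow_mul] at h
  have hinj := (Ideal.pow_right_strictAnti P hP0 hP.ne_top).injective h
  rw [hIeq]
  congr 1
  omega

/-! ### The prime of `K` above `3` (Dedekind's first species) -/

/-- For a cubic `K ∋ ∛m` with `3 ∤ m`, `m ≢ ±1 (mod 9)`: `3𝓞_K = 𝔮³` for a maximal ideal `𝔮`.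
[folklore] -/
theorem exists_span_three_eq_cube {K : Type*} [Field K] [NumberField K]
    {m : ℕ} (hm3 : ¬ 3 ∣ m) (hm1 : m % 9 ≠ 1) (hm8 : m % 9 ≠ 8)
    (hK : Module.finrank ℚ K = 3) {α : K} (hα : α ^ 3 = (m : K)) :
    ∃ q : Ideal (𝓞 K), q.IsMaximal ∧ (3 : 𝓞 K) ∈ q ∧ Ideal.span {(3 : 𝓞 K)} = q ^ 3 := by
  classical
  obtain ⟨𝔭, h𝔭def⟩ : ∃ 𝔭 : Ideal ℤ, 𝔭 = Ideal.span {((3 : ℕ) : ℤ)} := ⟨_, rfl⟩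
  haveI h𝔭max : 𝔭.IsMaximal := h𝔭def ▸
    Ideal.IsPrime.isMaximal ((Ideal.span_singleton_prime (by norm_num)).mpr
      (Nat.prime_iff_prime_int.mp Nat.prime_three)) (by simp)
  have h𝔭0 : 𝔭 ≠ ⊥ := by rw [h𝔭def, Ne, Ideal.span_singleton_eq_bot]; norm_num
  have hmem : ∀ (Q : Ideal (𝓞 K)) [Q.LiesOver 𝔭], (3 : 𝓞 K) ∈ Q := by
    intro Q _
    have h1 : ((3 : ℕ) : ℤ) ∈ Q.under ℤ := by
      rw [← Ideal.over_def Q 𝔭, h𝔭def]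
      exact Ideal.mem_span_singleton_self _
    rw [Ideal.under_def, Ideal.mem_comap, map_natCast] at h1
    exact_mod_cast h1
  have he : ∀ (Q : Ideal (𝓞 K)) [Q.IsMaximal] [Q.LiesOver 𝔭], Q.ramificationIdx ℤ = 3 := by
    intro Q _ _
    let v : HeightOneSpectrum (𝓞 K) := ⟨Q, Ideal.IsMaximal.isPrime inferInstance,
      Ideal.IsMaximal.ne_bot_of_isIntegral_int _⟩
    exact ramificationIdx_three_eq_three_of_mod_nine hm3 hm1 hm8 hK hα v (hmem Q)
  obtain ⟨Q, hQmax, hQover⟩ := Ideal.exists_maximal_ideal_liesOver_of_isIntegral (S := 𝓞 K) 𝔭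
  have hsum := Ideal.sum_ramification_inertia_eq_finrank 𝔭 (𝓞 K)
  rw [RingOfIntegers.rank, hK] at hsum
  let Q' : 𝔭.primesOver (𝓞 K) := ⟨Q, hQmax.isPrime, hQover⟩
  have hge : ∀ R : 𝔭.primesOver (𝓞 K), 3 ≤ R.1.ramificationIdx ℤ * R.1.inertiaDeg ℤ := by
    rintro ⟨R, hRp, hRl⟩
    haveI : R.IsMaximal := Ideal.IsMaximal.of_liesOver_isMaximal R 𝔭
    have h1 := he R
    have h4 : 0 < R.inertiaDeg ℤ := Ideal.inertiaDeg_pos _ _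
    change 3 ≤ R.ramificationIdx ℤ * R.inertiaDeg ℤ
    rw [h1]; nlinarith
  have huniq : ∀ R : 𝔭.primesOver (𝓞 K), R = Q' := by
    intro R
    by_contra hne
    have h2 : ∑ x ∈ ({R, Q'} : Finset (𝔭.primesOver (𝓞 K))),
        x.1.ramificationIdx ℤ * x.1.inertiaDeg ℤ ≤ 3 := by
      rw [← hsum]
      exact Finset.sum_le_sum_of_subset (Finset.subset_univ _)
    rw [Finset.sum_pair hne] at h2
    have := hge R
    have := hge Q'
    omega
  refine ⟨Q, hQmax, hmem Q, ?_⟩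
  have hI : Ideal.span {(3 : 𝓞 K)} = 𝔭.map (algebraMap ℤ (𝓞 K)) := by
    rw [h𝔭def, Ideal.map_span, Set.image_singleton, map_natCast]; norm_num
  have hI0 : 𝔭.map (algebraMap ℤ (𝓞 K)) ≠ ⊥ := by
    rw [← hI, Ne, Ideal.span_singleton_eq_bot]; norm_num
  have hcount := Ideal.IsDedekindDomain.ramificationIdx_eq_normalizedFactors_count 𝔭 Q hI0
  have hall : ∀ R ∈ UniqueFactorizationMonoid.normalizedFactors (𝔭.map (algebraMap ℤ (𝓞 K))),
      R = Q := by
    intro R hR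
    have hR' : R ∈ 𝔭.primesOver (𝓞 K) := by
      rw [← IsDedekindDomain.coe_primesOverFinset h𝔭0 (𝓞 K), Finset.mem_coe,
        Multiset.mem_toFinset, UniqueFactorizationMonoid.factors_eq_normalizedFactors]
      exact hR
    exact congrArg Subtype.val (huniq ⟨R, hR'⟩)
  have hnf : UniqueFactorizationMonoid.normalizedFactors (𝔭.map (algebraMap ℤ (𝓞 K))) =
      Multiset.replicate 3 Q := by
    have h := Multiset.eq_replicate_card.mpr hall
    rw [h, Multiset.count_replicate_self, he Q] at hcount
    rw [h, ← hcount]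
  rw [hI, ← Ideal.prod_normalizedFactors_eq_self hI0, hnf, Multiset.prod_replicate]

/-! ### The wild prime of `L = K(ζ₃)` for `m ≢ 0, ±1 (mod 9)` -/

/-- **The wild prime, general radicand.**  For `3 ∤ m`, `m ≢ ±1 (mod 9)`, a cubic `K ∋ ∛m`, a sextic
`L ⊇ K` and a quadratic subfield `F ∋ ζ₃` with `L/F` Galois cubic and `𝓞_F` a PID: there is a
maximal ideal `𝔏 ∋ 3` of `𝓞 L`, the only one above `3`, with `e(𝔏 | F) = 3`, `3𝓞_L = 𝔏⁶` and
`λ𝓞_L = 𝔏³` for a generator `λ` of `𝔏 ∩ 𝓞_F`. [folklore] -/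
theorem exists_wild_prime_of_mod_nine {m : ℕ} (hm3 : ¬ 3 ∣ m) (hm1 : m % 9 ≠ 1) (hm8 : m % 9 ≠ 8)
    {K : Type*} [Field K] [NumberField K] (hK : Module.finrank ℚ K = 3) {α : K}
    (hα : α ^ 3 = (m : K)) {L : Type*} [Field L] [NumberField L] [Algebra K L]
    (hL6 : Module.finrank ℚ L = 6) (F : IntermediateField ℚ L) [IsGalois F L]
    (hFL : Module.finrank F L = 3) (hF2 : Module.finrank ℚ F = 2)
    {ζ : 𝓞 F} (hζ : ζ ^ 2 + ζ + 1 = 0) (hPID : IsPrincipalIdealRing (𝓞 F)) :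
    ∃ Q : Ideal (𝓞 L), Q.IsMaximal ∧ (3 : 𝓞 L) ∈ Q ∧ Q.ramificationIdx (𝓞 F) = 3 ∧
      (∀ Q' : Ideal (𝓞 L), Q'.IsMaximal → (3 : 𝓞 L) ∈ Q' → Q' = Q) ∧
      (∃ t : 𝓞 F, Ideal.span {algebraMap (𝓞 F) (𝓞 L) t} = Q ^ 3) ∧
      Ideal.span {(3 : 𝓞 L)} = Q ^ 6 := by
  classical
  haveI : Fact (Nat.Prime 3) := ⟨Nat.prime_three⟩
  haveI hFcyc : IsCyclotomicExtension {3} ℚ F := Honda1971.isCyclotomicExtension_three F hF2 hζ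
  obtain ⟨𝔭, h𝔭def⟩ : ∃ 𝔭 : Ideal ℤ, 𝔭 = Ideal.span {((3 : ℕ) : ℤ)} := ⟨_, rfl⟩
  haveI h𝔭max : 𝔭.IsMaximal := h𝔭def ▸
    Ideal.IsPrime.isMaximal ((Ideal.span_singleton_prime (by norm_num)).mpr
      (Nat.prime_iff_prime_int.mp Nat.prime_three)) (by simp)
  have h𝔭0 : 𝔭 ≠ ⊥ := by rw [h𝔭def, Ne, Ideal.span_singleton_eq_bot]; norm_num
  have hmem : ∀ (Q : Ideal (𝓞 L)) [Q.LiesOver 𝔭], (3 : 𝓞 L) ∈ Q := by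
    intro Q _
    have h1 : ((3 : ℕ) : ℤ) ∈ Q.under ℤ := by
      rw [← Ideal.over_def Q 𝔭, h𝔭def]
      exact Ideal.mem_span_singleton_self _
    rw [Ideal.under_def, Ideal.mem_comap, map_natCast] at h1
    exact_mod_cast h1
  have heK : ∀ (Q : Ideal (𝓞 L)) [Q.IsMaximal] [Q.LiesOver 𝔭],
      Q.ramificationIdx ℤ = 3 * Q.ramificationIdx (𝓞 K) := by
    intro Q _ _
    haveI : (Q.under (𝓞 K)).IsMaximal := Ideal.IsMaximal.under _ Q
    have hne : Q.under (𝓞 K) ≠ ⊥ := Ideal.IsMaximal.ne_bot_of_isIntegral_int _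
    let v : HeightOneSpectrum (𝓞 K) := ⟨Q.under (𝓞 K), Ideal.IsMaximal.isPrime inferInstance, hne⟩
    have h3v : (3 : 𝓞 K) ∈ v.asIdeal := by
      change (3 : 𝓞 K) ∈ Q.under (𝓞 K)
      rw [Ideal.under_def, Ideal.mem_comap, map_ofNat]
      exact hmem Q
    have h3 : (Q.under (𝓞 K)).ramificationIdx ℤ = 3 :=
      ramificationIdx_three_eq_three_of_mod_nine hm3 hm1 hm8 hK hα v h3v
    rw [Ideal.ramificationIdx_tower (R := ℤ) (Q.under (𝓞 K)) Q, h3]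
  have heF : ∀ (Q : Ideal (𝓞 L)) [Q.IsMaximal] [Q.LiesOver 𝔭], Q.ramificationIdx (𝓞 F) = 3 := by
    intro Q _ _
    exact Honda1971.ramificationIdx_eq_three_of_three_dvd (F := F) (L := L) hFL hF2 Q
      ⟨_, heK Q⟩
  have he6 : ∀ (Q : Ideal (𝓞 L)) [Q.IsMaximal] [Q.LiesOver 𝔭], Q.ramificationIdx ℤ = 6 := by
    intro Q _ _
    haveI : (Q.under (𝓞 F)).IsMaximal := Ideal.IsMaximal.under _ Q
    haveI : (Q.under (𝓞 F)).LiesOver (Ideal.span {((3 : ℕ) : ℤ)}) := h𝔭def ▸ inferInstance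
    have h2 : (Q.under (𝓞 F)).ramificationIdx ℤ = 3 - 1 :=
      IsCyclotomicExtension.Rat.ramificationIdx_eq_of_prime 3 F (Q.under (𝓞 F))
    rw [Ideal.ramificationIdx_tower (R := ℤ) (Q.under (𝓞 F)) Q, h2, heF Q]
  obtain ⟨Q, hQmax, hQover⟩ := Ideal.exists_maximal_ideal_liesOver_of_isIntegral (S := 𝓞 L) 𝔭
  have hsum := Ideal.sum_ramification_inertia_eq_finrank 𝔭 (𝓞 L)
  rw [RingOfIntegers.rank, hL6] at hsum
  let Q' : 𝔭.primesOver (𝓞 L) := ⟨Q, hQmax.isPrime, hQover⟩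
  have hge : ∀ R : 𝔭.primesOver (𝓞 L), 6 ≤ R.1.ramificationIdx ℤ * R.1.inertiaDeg ℤ := by
    rintro ⟨R, hRp, hRl⟩
    haveI : R.IsMaximal := Ideal.IsMaximal.of_liesOver_isMaximal R 𝔭
    have h1 := he6 R
    have h4 : 0 < R.inertiaDeg ℤ := Ideal.inertiaDeg_pos _ _
    change 6 ≤ R.ramificationIdx ℤ * R.inertiaDeg ℤ
    rw [h1]; nlinarith
  have huniq : ∀ R : 𝔭.primesOver (𝓞 L), R = Q' := by
    intro R
    by_contra hne
    have h2 : ∑ x ∈ ({R, Q'} : Finset (𝔭.primesOver (𝓞 L))),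
        x.1.ramificationIdx ℤ * x.1.inertiaDeg ℤ ≤ 6 := by
      rw [← hsum]
      exact Finset.sum_le_sum_of_subset (Finset.subset_univ _)
    rw [Finset.sum_pair hne] at h2
    have := hge R
    have := hge Q'
    omega
  have huniq' : ∀ R : Ideal (𝓞 L), R.IsMaximal → (3 : 𝓞 L) ∈ R → R = Q := by
    intro R hR h3R
    have hRu : R.under ℤ = 𝔭 := by
      have hne : R ≠ ⊥ := Ideal.IsMaximal.ne_bot_of_isIntegral_int R
      let w : HeightOneSpectrum (𝓞 L) := ⟨R, hR.isPrime, hne⟩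
      have := Honda1971.under_int_eq_span Nat.prime_three w (by exact_mod_cast h3R)
      rw [h𝔭def]; exact this
    haveI : R.LiesOver 𝔭 := ⟨hRu.symm⟩
    exact congrArg Subtype.val (huniq ⟨R, hR.isPrime, inferInstance⟩)
  have hI : Ideal.span {(3 : 𝓞 L)} = 𝔭.map (algebraMap ℤ (𝓞 L)) := by
    rw [h𝔭def, Ideal.map_span, Set.image_singleton, map_natCast]; norm_num
  have hI0 : 𝔭.map (algebraMap ℤ (𝓞 L)) ≠ ⊥ := by
    rw [← hI, Ne, Ideal.span_singleton_eq_bot]; norm_num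
  refine ⟨Q, hQmax, hmem Q, heF Q, huniq', ?_, ?_⟩
  · haveI := hPID
    haveI : (Q.under (𝓞 F)).IsMaximal := Ideal.IsMaximal.under _ Q
    have hq0 : Q.under (𝓞 F) ≠ ⊥ := Ideal.IsMaximal.ne_bot_of_isIntegral_int _
    obtain ⟨t, ht⟩ := (IsPrincipalIdealRing.principal (Q.under (𝓞 F))).principal
    refine ⟨t, ?_⟩
    have hM : (Q.under (𝓞 F)).map (algebraMap (𝓞 F) (𝓞 L)) =
        Ideal.span {algebraMap (𝓞 F) (𝓞 L) t} := by
      rw [ht, Ideal.submodule_span_eq, Ideal.map_span, Set.image_singleton]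
    rw [← hM, Ideal.map_algebraMap_eq_finsetProd_pow (R := 𝓞 L) hq0]
    have hset : (Ideal.primesOver (Q.under (𝓞 F)) (𝓞 L)).toFinset = {Q} := by
      ext R
      simp only [Set.mem_toFinset, Finset.mem_singleton]
      constructor
      · intro hR
        haveI := hR.1
        haveI := hR.2
        haveI : R.IsMaximal := hR.1.isMaximal (Ideal.ne_bot_of_mem_primesOver hq0 hR)
        haveI : R.LiesOver 𝔭 := Ideal.LiesOver.trans R (Q.under (𝓞 F)) 𝔭
        exact huniq' R inferInstance (hmem R)
      · rintro rfl
        exact ⟨hQmax.isPrime, ⟨rfl⟩⟩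
    rw [hset, Finset.prod_singleton, heF Q]
  · have hcount := Ideal.IsDedekindDomain.ramificationIdx_eq_normalizedFactors_count 𝔭 Q hI0
    have hall : ∀ R ∈ UniqueFactorizationMonoid.normalizedFactors (𝔭.map (algebraMap ℤ (𝓞 L))),
        R = Q := by
      intro R hR
      have hR' : R ∈ 𝔭.primesOver (𝓞 L) := by
        rw [← IsDedekindDomain.coe_primesOverFinset h𝔭0 (𝓞 L), Finset.mem_coe,
          Multiset.mem_toFinset, UniqueFactorizationMonoid.factors_eq_normalizedFactors]
        exact hR
      exact congrArg Subtype.val (huniq ⟨R, hR'⟩)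
    have hnf : UniqueFactorizationMonoid.normalizedFactors (𝔭.map (algebraMap ℤ (𝓞 L))) =
        Multiset.replicate 6 Q := by
      have h := Multiset.eq_replicate_card.mpr hall
      rw [h, Multiset.count_replicate_self, he6 Q] at hcount
      rw [h, ← hcount]
    rw [hI, ← Ideal.prod_normalizedFactors_eq_self hI0, hnf, Multiset.prod_replicate]

/-! ### Field set-up for two inert primes -/

/-- **Field set-up for `K ∋ ∛(pq)`, `p, q ≡ 2 (mod 3)` distinct primes** (any residues mod `9`):
`L = K(ζ₃)` (`[L:K] = 2`, `[L:ℚ] = 6`, Galois over `ℚ`), `F = ℚ(ζ₃)` (`[F:ℚ] = 2`, `L/F` cyclic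
cubic, `𝓞_F` a PID, `F` totally complex, units `±ζ₃^i`, `ζ₃² + ζ₃ + 1 = 0` in `𝓞_F`), `θ = α`
with `[ℚ(θ):ℚ] = 3`, and the totally ramified primes `P₁ ∋ p`, `P₂ ∋ q` (`p𝓞_L = P₁³`,
`q𝓞_L = P₂³`, `e = 3`). [folklore] -/
theorem fieldSetup_twoPrimes {p q : ℕ} (hp : p.Prime) (hq : q.Prime) (hpq : p ≠ q)
    (hp3 : p % 3 = 2) (hq3 : q % 3 = 2) (K : Type*) [Field K]
    [NumberField K] (hK : Module.finrank ℚ K = 3) {α : K} (hα : α ^ 3 = ((p * q : ℕ) : K))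
    (L : Type*) [Field L] [NumberField L] [Algebra K L] [IsCyclotomicExtension {3} K L] :
    Module.finrank K L = 2 ∧ Module.finrank ℚ L = 6 ∧ IsGalois ℚ L ∧
      ∃ F : IntermediateField ℚ L,
        IsGalois F L ∧ Module.finrank F L = 3 ∧ Module.finrank ℚ F = 2 ∧
        (∃ σ : L ≃ₐ[F] L, ∀ τ : L ≃ₐ[F] L, τ ∈ Subgroup.zpowers σ) ∧
        IsPrincipalIdealRing (𝓞 F) ∧
        (∀ v : NumberField.InfinitePlace F, v.IsComplex) ∧
        (∃ θ : L, θ ^ 3 = ((p * q : ℕ) : L) ∧ Module.finrank ℚ ℚ⟮θ⟯ = 3) ∧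
        ∃ ζ : (𝓞 F)ˣ, ((ζ : 𝓞 F) : F) ^ 3 = 1 ∧ ((ζ : 𝓞 F) : F) ≠ 1 ∧
          (ζ : 𝓞 F) ^ 2 + (ζ : 𝓞 F) + 1 = 0 ∧
          (∀ w : (𝓞 F)ˣ, ∃ i : ℕ, w = ζ ^ i ∨ w = -ζ ^ i) ∧
          ∃ P₁ P₂ : Ideal (𝓞 L), P₁.IsMaximal ∧ P₂.IsMaximal ∧ P₁ ≠ P₂ ∧
            (p : 𝓞 L) ∈ P₁ ∧ (q : 𝓞 L) ∈ P₂ ∧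
            Ideal.span {(p : 𝓞 L)} = P₁ ^ 3 ∧ Ideal.span {(q : 𝓞 L)} = P₂ ^ 3 ∧
            P₁.ramificationIdx (𝓞 F) = 3 ∧ P₂.ramificationIdx (𝓞 F) = 3 := by
  have hKL : Module.finrank K L = 2 := by
    rw [IsCyclotomicExtension.finrank L (irreducible_cyclotomic_three_of_finrank_eq_three hK),
      Nat.totient_prime Nat.prime_three]
  have hL6 : Module.finrank ℚ L = 6 := by
    rw [← Module.finrank_mul_finrank ℚ K L, hK, hKL]
  obtain ⟨ζ, hζ⟩ : ∃ ζ : L, IsPrimitiveRoot ζ 3 := ⟨_, IsCyclotomicExtension.zeta_spec 3 K L⟩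
  haveI hGal : IsGalois ℚ L := isGalois_rat_of_isCyclotomicExtension_three hp hq hpq hK hα L
  haveI hF : IsCyclotomicExtension {3} ℚ ℚ⟮ζ⟯ :=
    hζ.intermediateField_adjoin_isCyclotomicExtension ℚ
  have hF2 : Module.finrank ℚ ℚ⟮ζ⟯ = 2 := by
    rw [IsCyclotomicExtension.finrank (n := 3) ℚ⟮ζ⟯ (cyclotomic.irreducible_rat (by norm_num)),
      Nat.totient_prime Nat.prime_three]
  have hFL : Module.finrank ℚ⟮ζ⟯ L = 3 := by
    have h := Module.finrank_mul_finrank ℚ ℚ⟮ζ⟯ L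
    rw [hF2, hL6] at h
    omega
  have hθ : ∃ θ : L, θ ^ 3 = ((p * q : ℕ) : L) ∧ Module.finrank ℚ ℚ⟮θ⟯ = 3 := by
    refine ⟨algebraMap K L α, by rw [← map_pow, hα, map_natCast], ?_⟩
    have hθ3 : (algebraMap K L α) ^ 3 = ((p * q : ℕ) : L) := by rw [← map_pow, hα, map_natCast]
    have hint : IsIntegral ℚ (algebraMap K L α) := .of_finite ℚ _
    rw [IntermediateField.adjoin.finrank hint, Honda1971.minpoly_eq hp hq hpq hθ3,
      natDegree_X_pow_sub_C]
  refine ⟨hKL, hL6, hGal, ℚ⟮ζ⟯, inferInstance, hFL, hF2, ?_, IsCyclotomicExtension.Rat.three_pid ℚ⟮ζ⟯,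
    (IsCyclotomicExtension.Rat.isTotallyComplex ℚ⟮ζ⟯ (n := 3) (by norm_num)).isComplex, hθ, ?_⟩
  · haveI : Fact (Nat.Prime 3) := ⟨Nat.prime_three⟩
    haveI : IsCyclic (L ≃ₐ[ℚ⟮ζ⟯] L) :=
      isCyclic_of_prime_card (p := 3) (by rw [IsGalois.card_aut_eq_finrank, hFL])
    exact IsCyclic.exists_generator
  have hζF : IsPrimitiveRoot (⟨ζ, IntermediateField.mem_adjoin_simple_self ℚ ζ⟩ : ℚ⟮ζ⟯) 3 :=
    IsPrimitiveRoot.coe_submonoidClass_iff.mp hζ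
  obtain ⟨η, hη, hunits⟩ := exists_units_eq_pow_or_neg_pow hζF
  refine ⟨η, ?_, ?_, ?_, hunits, ?_⟩
  · rw [hη]; exact hζF.pow_eq_one
  · rw [hη]; exact hζF.ne_one (by norm_num)
  · have h3 := hζF.pow_eq_one
    have h1 := hζF.ne_one (by norm_num)
    rw [← hη] at h3 h1
    have hfac : (((η : 𝓞 ℚ⟮ζ⟯) : ℚ⟮ζ⟯) - 1) *
        (((η : 𝓞 ℚ⟮ζ⟯) : ℚ⟮ζ⟯) ^ 2 + ((η : 𝓞 ℚ⟮ζ⟯) : ℚ⟮ζ⟯) + 1) = 0 := by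
      linear_combination h3
    have hF' : ((η : 𝓞 ℚ⟮ζ⟯) : ℚ⟮ζ⟯) ^ 2 + ((η : 𝓞 ℚ⟮ζ⟯) : ℚ⟮ζ⟯) + 1 = 0 := by
      rcases mul_eq_zero.mp hfac with h | h
      · exact absurd (sub_eq_zero.mp h) h1
      · exact h
    apply RingOfIntegers.coe_injective
    push_cast
    exact hF'
  obtain ⟨P₁, hP₁, hpP₁, hspan₁, he₁, -, -⟩ :=
    exists_prime_pow_three_eq_span ℚ⟮ζ⟯ hL6 hp hq hpq hp3 hK hα
  have hα' : α ^ 3 = ((q * p : ℕ) : K) := by rwa [Nat.mul_comm]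
  obtain ⟨P₂, hP₂, hqP₂, hspan₂, he₂, -, -⟩ :=
    exists_prime_pow_three_eq_span ℚ⟮ζ⟯ hL6 hq hp hpq.symm hq3 hK hα'
  refine ⟨P₁, P₂, hP₁, hP₂, ?_, hpP₁, hqP₂, hspan₁, hspan₂, he₁, he₂⟩
  rintro rfl
  have hcop : IsCoprime (p : 𝓞 L) (q : 𝓞 L) := by
    have h' : IsCoprime (p : ℤ) (q : ℤ) :=
      Nat.isCoprime_iff_coprime.mpr ((Nat.coprime_primes hp hq).mpr hpq)
    simpa using h'.map (Int.castRingHom (𝓞 L))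
  obtain ⟨a, b, hab⟩ := hcop
  exact hP₁.ne_top ((Ideal.eq_top_iff_one _).mpr
    (hab ▸ P₁.add_mem (P₁.mul_mem_left a hpP₁) (P₁.mul_mem_left b hqP₂)))

end Summit.QuantumAdvantage.QuantumAdvantage.Theorems.LinnikCubicClassGroups

end
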